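import Mathlib.Analysis.SpecialFunctions.Pow.Real
import Literature.NumberTheory.Transcendental.AntiEFunction
import HarnessLib
import HarnessLib.Audit

/-!
# Fischler–Rivoal's Corollary 1: `∫₀^∞ (t+α)^s e^{−t} dt` is transcendental under their Э-division Conjecture 2

Topic `Literature/NumberTheory/Transcendental`. One NAMED FACT — a printed CONDITIONAL theorem whose
antecedent is the source's (unproved) Conjecture 2, stated INLINE (the gate files unproved conjectures
as obligations under `Summits/…/Theorems`, which a Literature file may not import; so the printed
implication is recorded here as one self-contained statement) — over the tree's Э-function vocabulary `Literature/NumberTheory/Transcendental/AntiEFunction.lean`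
(`antiESeries`, `IsAntiEFunction`, `IsAntiESum` — that file's docstring: "so that its Conjecture 2 /
Theorems 3–4 can be typed verbatim"; "NOT here: … Fischler–Rivoal's Conjectures 1–3 / Theorems 3–4
(to be stated by their users over these definitions)"). Filed while grounding route
`Schanuel/GaussianStokesSector` (support `AntiEValueTranscendental` = `stmt-Schanuel-13747`, the
verbatim twin of the retired `StokesConstantPi.AntiEValueTranscendental` = `stmt-Schanuel-3727`).

Source (held, read: arXiv:2301.13518 = J. Number Theory 261 (2024), §1, p. 4 of the arXiv text):

* « **Conjecture 2.** Let `𝔣(z)` be an Э-function and `θ ∈ (−π/2, π/2)` be such that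
  `𝔣_θ(1) = 0`. Then `𝔣(z)/(z−1)` is an Э-function. » — introduced by « André discussed the
  situation in [andre2] and even though he did not formulate exactly the following conjecture, it
  seems plausible to us. … Ferguson essentially stated this conjecture when `𝔣(z)` has rational
  coefficients and when `θ = 0`. » It is the Э-analogue of Theorem 1 (i) [André, Beukers]: « If an
  `E`-function `F(z)` is such that `F(1) = 0`, then `F(z)/(z−1)` is an `E`-function. »
* « **Corollary 1.** Assume that Conjecture 2 holds. Then for any `α ∈ ℚ̄`, `α > 0`, and any
  `s ∈ ℚ ∖ ℤ_{≥0}`, the number `∫₀^∞ (t+α)^s e^{−t} dt` is a transcendental number. In particular,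
  Gompertz's constant `δ := ∫₀^∞ e^{−t}/(t+1) dt` is a transcendental number. » (deduced in §5 of
  the source from Theorem 3, the conditional Э-analogue of Beukers' theorem.)

Lean rendering.
* An Э-function is `antiESeries a` with `IsStrictEFunction a` (`isAntiEFunction_iff_exists`);
  "`θ ∈ (−π/2, π/2)` such that `𝔣_θ(1) = 0`" is `IsAntiESum a θ 1 0` — the `1`-sum of `𝔣_a(1/z)`
  in the direction `θ` ([FischlerRivoal2024] labelling, as provided by `AntiEFunction.lean`) exists
  at `z = 1` and equals `0` (for an anti-Stokes `θ` no such sum exists and the hypothesis is void,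
  matching the source, where `𝔣_θ` is only defined off the anti-Stokes directions);
  "`𝔣(z)/(z−1)` is an Э-function" is rendered without division as "there is an Э-function `g` with
  `(z − 1)·g(z) = 𝔣(z)`" (`z − 1` is a unit of `ℂ⟦z⟧`, so `g = 𝔣/(z−1)` is that unique series).
* In Corollary 1, "`α ∈ ℚ̄`, `α > 0`" is a positive real algebraic number, "`s ∈ ℚ ∖ ℤ_{≥0}`" is a
  rational `s` with `s ≠ n` for every `n : ℕ` (negative integers allowed: `s = −1` is Gompertz's
  constant), and `∫₀^∞ (t+α)^s e^{−t} dt` is the (absolutely convergent) Bochner integral over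
  `Ioi 0` of the real function `t ↦ (t + α)^s · e^{−t}` (`Real.rpow` of the positive base `t + α`).
  The instance `α = 1`, `s = −1/2` is `∫₀^∞ e^{−t}/√(1+t) dt = e·Γ(1/2, 1)`, the number of
  `Summit.Schanuel.Schanuel.Theses.GaussianStokesSector.AntiEValueTranscendental` (there written
  `∫ x in Ioi 0, Real.exp (-x) / Real.sqrt (1 + x)`; same integrand by `Real.sqrt_eq_rpow`,
  `Real.rpow_neg`, `add_comm`).

Nothing is proved here: `FischlerRivoal2024_corollary1` is named-fact debt (its discharge = the
source's §5, Beukers' method for Э-functions under the division hypothesis, on top of the analytic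
theory of `1`-summation, none of which is in the tree). Its antecedent (Conjecture 2 of the source) is
not known, and unconditionally every instance of the conclusion is unsettled (for `s = −1` even the
irrationality of Gompertz's constant, loc. cit.), so the fact is informative exactly as the printed
corollary is: as an implication. Deliberately NOT in this file: Conjecture 1 (`𝐄 ∩ 𝐃 = ℚ̄`),
Theorem 3, and the mixed-function Conjecture 3 / Theorem 4 (they need the notion of mixed function,
[FischlerRivoal2024, Def. 1], not yet in the tree); a stand-alone declaration of Conjecture 2 (to be
filed as an obligation `Summits/Schanuel/Schanuel/Theorems/…` by a prover/planner if a route wants it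
as a crux; its Lean text is the antecedent below, verbatim).

## References

* S. Fischler, T. Rivoal, *Relations between values of arithmetic Gevrey series, and applications to
  values of the Gamma function*, J. Number Theory 261 (2024) 36–54 (arXiv:2301.13518), §1:
  Conjecture 2, Theorem 3, Corollary 1. [`FischlerRivoal2024`]
-/

noncomputable section

namespace Literature.NumberTheory.Transcendental

open Literature.Barriers.Schanuel MeasureTheory Set

/-- NAMED FACT — **Fischler–Rivoal 2024, Corollary 1** (a conditional theorem, as printed):
« Assume that Conjecture 2 holds. Then for any `α ∈ ℚ̄`, `α > 0`, and any `s ∈ ℚ ∖ ℤ_{≥0}`, the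
number `∫₀^∞ (t+α)^s e^{−t} dt` is a transcendental number. In particular, Gompertz's constant
`δ := ∫₀^∞ e^{−t}/(t+1) dt` is a transcendental number. » The ANTECEDENT is the source's Conjecture 2
(Э-division), inlined verbatim: « Let `𝔣(z)` be an Э-function and `θ ∈ (−π/2, π/2)` be such that
`𝔣_θ(1) = 0`. Then `𝔣(z)/(z−1)` is an Э-function » — here `𝔣 = 𝔣_a = ∑ n!·aₙ·zⁿ` (`antiESeries a`,
`IsStrictEFunction a`), `𝔣_θ(1) = 0` is `IsAntiESum a θ 1 0` (the `1`-sum in the direction `θ`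
exists at `z = 1` and vanishes), and the conclusion says `𝔣(z) = (z − 1)·g(z)` for some Э-function
`g` (`z − 1` is a unit of `ℂ⟦z⟧`). The CONSEQUENT: `α` a positive real algebraic number, `s` rational
and not a non-negative integer, and the absolutely convergent integral `∫₀^∞ (t+α)^s e^{−t} dt =
e^{α}Γ(s+1, α)` (Bochner integral over `Ioi 0`, `Real.rpow` of the positive base `t + α`) is
transcendental. The instance `α = 1`, `s = −1/2`, `∫₀^∞ e^{−t}(1+t)^{−1/2} dt = e·Γ(1/2, 1)`,
grounds — conditionally on the antecedent — the route declaration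
`Summit.Schanuel.Schanuel.Theses.GaussianStokesSector.AntiEValueTranscendental` (and its retired twin
`…Theses.StokesConstantPi.AntiEValueTranscendental`). Not discharged: users take
`(h : FischlerRivoal2024_corollary1)`. [cite: FischlerRivoal2024, Corollary 1 (§1, p. 4)] -/
def FischlerRivoal2024_corollary1 : Prop :=
  (∀ (a : ℕ → ℂ), IsStrictEFunction a →
      ∀ θ : ℝ, θ ∈ Ioo (-(Real.pi / 2)) (Real.pi / 2) → IsAntiESum a θ 1 0 →
        ∃ g : PowerSeries ℂ, IsAntiEFunction g ∧ (PowerSeries.X - 1) * g = antiESeries a) →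
    ∀ (α : ℝ), IsAlgebraic ℚ α → 0 < α → ∀ s : ℚ, (∀ n : ℕ, s ≠ n) →
      Transcendental ℚ (∫ t in Ioi (0 : ℝ), (t + α) ^ (s : ℝ) * Real.exp (-t))

end Literature.NumberTheory.Transcendental

end
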